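import Summits.CriticalPhenomena.PercolationContinuityZ3.Theorems.Transplant.SkelPhiInfClusterMeets
import Summits.CriticalPhenomena.PercolationContinuityZ3.Theorems.Transplant.SkelPhiEquilibriumLimits
import HarnessLib

/-!
# N1 (the `{±1}` node), LEVEL 0, (L0-2) IN THE CONSUMER'S SHAPE: `Skelφ.Eq.MeetsAS G p Q` ("a.s. every infinite open cluster meets `Q`") for every
# region holding far boxes of a skeleton with frames — in particular for the STRIP COMPLEMENT `(Eq.strip φ t n)ᶜ` (Martineau–Tassion's Fact 2,
# `V ∖ Y`) and the CO-QUADRANT `(Eq.Xinf φ t σ M)ᶜ` (Fact 1, `V ∖ X`) that p3-g8's `SkelPhiEquilibriumLimits` / Fact 1 take as hypotheses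

builds on p205010 (kernel theorem, internal audit signed; external expert review pending) — nothing in this file uses p205010; nothing here is a
claim about the open node `SamePDropOfSkeletonNeg`.
Lane `prim-bschramm`, seat `prim-bschramm-p1` (gen 11; design owner's binding consumer shape, lane INBOX 2026-08-21T12:13:00Z); helper file
(`--supports stmt-CriticalPhenomena-4575 --as helper`).  Everything is a one-line specialisation of `SkelPhiInfClusterMeets` (p266475):
`Skelφ.ae_reachable_of_farBoxes` ⇒ `MeetsAS`, `FarBoxes.mono` + `farBoxes_halfPlane` / `farBoxes_quadrant` for the two regions.
* `Skelφ.meetsAS_of_farBoxes` (hypotheses: `G.Preconnected`, `Countable V`, `Frames`, `Steps`, `Lip`, an anchor vertex, a.s. uniqueness at `p`, `FarBoxes φ Q`);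
* `Skelφ.halfPlane_subset_compl_strip`, **`Skelφ.meetsAS_compl_strip`** (`(strip φ t n)ᶜ ⊇` the half-plane `{n + 1 ≤ α}`);
* `Skelφ.quadrant_subset_compl_Xinf`, **`Skelφ.meetsAS_compl_Xinf`** (`(Xinf φ t σ M)ᶜ = {σα ≥ M+1, β < −(M+1)} ⊇` the quadrant `{M+1 ≤ σα, M+2 ≤ −β}`);
* `PlanarSkeletonNeg.meetsAS_compl_strip`, `PlanarSkeletonNeg.meetsAS_compl_Xinf` (the node's binders: `Φ`, `G.Connected`, `hU`).
[cite: MartineauTassion2017, §3.1.2 Lemma 3.4 (second part; arXiv p. 9); §3.2 proof of Lemma 3.5, (13) and Fact 2 (arXiv p. 10)]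
-/

noncomputable section

open MeasureTheory

namespace Summit.CriticalPhenomena.PercolationContinuityZ3.Theorems.Transplant

namespace Skelφ

open Literature.Probability.Percolation Literature.Probability.LatticeModels SimpleGraph

variable {V : Type} {G : SimpleGraph V} {φ : V → Site 2} {types : Finset V}

/-- **`MeetsAS` for every region holding far boxes** (connected `G`, countable `V`, `Frames`/`Steps`/`Lip`, a.s. uniqueness at `p`).
[cite: MartineauTassion2017, §3.1.2 Lemma 3.4 (second part; arXiv p. 9)] -/
theorem meetsAS_of_farBoxes [Countable V] (hc : G.Preconnected) (hfr : Frames G φ types) (hstep : Steps G φ) (hlip : Lip G φ) (w₀ : V)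
    {p : unitInterval} (hU : ∀ᵐ ω ∂bondPercolation G p, numInfiniteClusters ω ≤ 1) {Q : Set V} (hQ : FarBoxes φ Q) : Eq.MeetsAS G p Q := by
  filter_upwards [ae_reachable_of_farBoxes hc hfr hstep hlip w₀ hU hQ] with ω hω x hx
  obtain ⟨q, hq, -, hxq⟩ := hω x hx
  exact ⟨q, hq, hxq⟩

/-- The half-plane `{n + 1 ≤ α}` lies outside the strip `{|α| ≤ n}`. [folklore] -/
theorem halfPlane_subset_compl_strip (t : V) (n : ℕ) : halfPlane φ t 0 1 ((n : ℤ) + 1) ⊆ (Eq.strip φ t n)ᶜ := by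
  intro w hw hws
  rw [mem_halfPlane, Units.val_one, one_mul] at hw
  rw [Eq.mem_strip, abs_le] at hws
  linarith [hws.2]

/-- **`MeetsAS` for the strip complement `V ∖ Y`** (Martineau–Tassion's Fact 2 input). [cite: MartineauTassion2017, §3.2 proof of Lemma 3.5, Fact 2 (arXiv p. 10)] -/
theorem meetsAS_compl_strip [Countable V] (hc : G.Preconnected) (hfr : Frames G φ types) (hstep : Steps G φ) (hlip : Lip G φ)
    {p : unitInterval} (hU : ∀ᵐ ω ∂bondPercolation G p, numInfiniteClusters ω ≤ 1) (t : V) (n : ℕ) : Eq.MeetsAS G p (Eq.strip φ t n)ᶜ :=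
  meetsAS_of_farBoxes hc hfr hstep hlip t hU ((farBoxes_halfPlane t 0 1 ((n : ℤ) + 1)).mono (halfPlane_subset_compl_strip t n))

/-- The quadrant `{M + 1 ≤ σα, M + 2 ≤ −β}` lies outside `Xinf σ M = {σα < M+1 ∨ −(M+1) ≤ β}`. [folklore] -/
theorem quadrant_subset_compl_Xinf (t : V) (σ : ℤˣ) (M : ℕ) :
    quadrant φ t (fun i => if i = 0 then σ else -1) (fun i => if i = 0 then (M : ℤ) + 1 else (M : ℤ) + 2) ⊆ (Eq.Xinf φ t σ M)ᶜ := by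
  intro w hw hX
  rw [mem_quadrant] at hw
  have h0 := hw 0
  have h1 := hw 1
  simp only [if_true, show (1 : Fin 2) ≠ 0 by decide, if_false, Units.val_neg, Units.val_one] at h0 h1
  rcases hX with h | h
  · linarith
  · linarith

/-- **`MeetsAS` for the co-quadrant `V ∖ X`** (Martineau–Tassion's Fact 1 input; both signs `σ`). [cite: MartineauTassion2017, §3.2 proof of Lemma 3.5, (13) (arXiv p. 10)] -/
theorem meetsAS_compl_Xinf [Countable V] (hc : G.Preconnected) (hfr : Frames G φ types) (hstep : Steps G φ) (hlip : Lip G φ)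
    {p : unitInterval} (hU : ∀ᵐ ω ∂bondPercolation G p, numInfiniteClusters ω ≤ 1) (t : V) {σ : ℤ} (hσ : σ = 1 ∨ σ = -1) (M : ℕ) :
    Eq.MeetsAS G p (Eq.Xinf φ t σ M)ᶜ := by
  obtain ⟨u, rfl⟩ : ∃ u : ℤˣ, (u : ℤ) = σ := by
    rcases hσ with rfl | rfl
    · exact ⟨1, rfl⟩
    · exact ⟨-1, rfl⟩
  exact meetsAS_of_farBoxes hc hfr hstep hlip t hU ((farBoxes_quadrant t _ _).mono (quadrant_subset_compl_Xinf t u M))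

end Skelφ

namespace PlanarSkeletonNeg

open Literature.Probability.Percolation Literature.Probability.LatticeModels SimpleGraph

variable {V : Type} {G : SimpleGraph V} [G.LocallyFinite] (Φ : PlanarSkeletonNeg G)

/-- **Fact 2's input for the node**: a.s. every infinite cluster meets the complement of every strip of the skeleton. [cite: MartineauTassion2017, §3.2 Fact 2] -/
theorem meetsAS_compl_strip [Countable V] (hc : G.Connected) {p : unitInterval} (hU : ∀ᵐ ω ∂bondPercolation G p, numInfiniteClusters ω ≤ 1)
    (t : V) (n : ℕ) : Skelφ.Eq.MeetsAS G p (Skelφ.Eq.strip Φ.φ t n)ᶜ :=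
  Skelφ.meetsAS_compl_strip hc.preconnected Φ.frame Φ.step Φ.lip hU t n

/-- **Fact 1's input for the node**: a.s. every infinite cluster meets the co-quadrant `(Xinf σ M)ᶜ`, both signs. [cite: MartineauTassion2017, §3.2 Fact 1] -/
theorem meetsAS_compl_Xinf [Countable V] (hc : G.Connected) {p : unitInterval} (hU : ∀ᵐ ω ∂bondPercolation G p, numInfiniteClusters ω ≤ 1)
    (t : V) {σ : ℤ} (hσ : σ = 1 ∨ σ = -1) (M : ℕ) : Skelφ.Eq.MeetsAS G p (Skelφ.Eq.Xinf Φ.φ t σ M)ᶜ :=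
  Skelφ.meetsAS_compl_Xinf hc.preconnected Φ.frame Φ.step Φ.lip hU t hσ M

end PlanarSkeletonNeg

end Summit.CriticalPhenomena.PercolationContinuityZ3.Theorems.Transplant

end
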